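import Summits.MatrixMultiplication.MatrixMultiplication.Theorems.AbelianSTPPCensusShapeCertVQKDefs
import Summits.MatrixMultiplication.MatrixMultiplication.Theorems.AbelianSTPPCensusShapeCertVQBounds
import Summits.MatrixMultiplication.MatrixMultiplication.Theorems.AbelianSTPPCensusShapeCertFinal

/-!
# Abelian STPP census — soundness of `ShapeCertVQ.checkQK`, part 1: the E3K condition on shape multisets and the E3K node kill

Cell mm-stpp, rung F-M1; successor kernel item «vQK T_E ladder beyond 471» in support of the closed crux item
stmt-MatrixMultiplication-19191; seat mm-stpp-vp-p2 (gen 3).  Semantic vocabulary and the new facts behind the one addition of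
`…ShapeCertVQKDefs` to g2's search (everything else is g1/g2's `AboveQ` theory, reused):
* `knLBd_divsQ`, `e3kLHSd_divsQ` — the divisor-list forms evaluate eng-2's `knLB` / `e3kLHS` (by `rfl`);
* `knLB_add_knLB_le`, `InUniv.knLB_pairs` — the side conditions of eng-2's heredity lemma `STPPThreeRoomEnergy.e3kLHS_mono`
  (`knLB M x + knLB M y ≤ M + 1` for the three letter pairs) hold for EVERY universe shape (positive sides, `abc + max ≤ M`):
  either a side is `1` (`knLB M 1 ≤ 1`, `knLB M y ≤ M`) or `2(x + y) ≤ xy + 4 ≤ M + 2`;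
* `AdmK` — the E3K condition on a multiset of triples (three pair classes; multiset form of `STPPThreeRoomEnergy.E3kAdm`),
  `AdmK.mono` — it passes to sub-multisets inside the universe (heredity), `admK_GM` — `E3kAdm M a b c` gives `AdmK M` on the shape
  multiset `ShapeCert.GM a b c`;
* **`AboveQ.false_of_e3kKillT` / `AboveQ.false_of_killK` / `AboveQ.false_of_killEK`** — the E3K node kill is sound: a prefix member
  killed with the prefix's off-member sums refutes `AdmK M G` for every family `G` above the prefix.
WHAT THIS IS NOT: no statement about STPP families or `ω` by itself; no new rule.
-/

set_option linter.dupNamespace false -- `MatrixMultiplication.MatrixMultiplication` (summit = problem, D-0017)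
set_option autoImplicit false

namespace Summit.MatrixMultiplication.MatrixMultiplication.Theorems.ShapeCertVQ

open ShapeCert ShapeCertVP STPPThreeRoomEnergy Multiset

/-! ### The divisor-list forms are the originals -/

/-- `knLBd (divsQ M) n = knLB M n` [bookkeeping] -/
theorem knLBd_divsQ (M n : ℕ) : knLBd (divsQ M) n = knLB M n := rfl

/-- `e3kLHSd (divsQ M) M = e3kLHS M` [bookkeeping] -/
theorem e3kLHSd_divsQ (M x y z SA SB SC : ℕ) : e3kLHSd (divsQ M) M x y z SA SB SC = e3kLHS M x y z SA SB SC := rfl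

/-! ### The side conditions of `e3kLHS_mono` hold in the universe -/

/-- `knLB M p + knLB M q ≤ M + 1` for positive `p, q ≤ M` with `pq + 2 ≤ M` unless one of them is `1`. [bookkeeping] -/
theorem knLB_add_knLB_le {M p q : ℕ} (hp : 1 ≤ p) (hq : 1 ≤ q) (hpM : p ≤ M) (hqM : q ≤ M)
    (hpq : 2 ≤ p → 2 ≤ q → p * q + 2 ≤ M) : knLB M p + knLB M q ≤ M + 1 := by
  have h1 := knLB_le_init M p
  have h2 := knLB_le_init M q
  by_cases hp1 : p = 1
  · subst hp1
    have := knLB_le_self hq hqM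
    omega
  by_cases hq1 : q = 1
  · subst hq1
    have := knLB_le_self hp hpM
    omega
  have hp2 : 2 ≤ p := by omega
  have hq2 : 2 ≤ q := by omega
  have h3 := hpq hp2 hq2
  obtain ⟨a, rfl⟩ := Nat.exists_eq_add_of_le hp2
  obtain ⟨b, rfl⟩ := Nat.exists_eq_add_of_le hq2
  have h4 : 2 * (2 + a) + 2 * (2 + b) ≤ (2 + a) * (2 + b) + 4 := by nlinarith [Nat.zero_le (a * b)]
  omega

/-- **the three letter-pair conditions of `e3kLHS_mono` for a universe shape** [bookkeeping] -/
theorem _root_.Summit.MatrixMultiplication.MatrixMultiplication.Theorems.ShapeCert.InUniv.knLB_pairs {M : ℕ} {x : ℕ × ℕ × ℕ}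
    (h : InUniv M x) :
    knLB M x.1 + knLB M x.2.1 ≤ M + 1 ∧ knLB M x.2.1 + knLB M x.2.2 ≤ M + 1 ∧ knLB M x.2.2 + knLB M x.1 ≤ M + 1 := by
  obtain ⟨p1, p2, p3⟩ := h.pos
  have hv := h.vol_le
  have ha := h.a_le; have hb := h.b_le; have hc := h.c_le
  unfold vol at hv
  refine ⟨knLB_add_knLB_le p1 p2 ha hb fun h2 _ => ?_, knLB_add_knLB_le p2 p3 hb hc fun h2 _ => ?_,
    knLB_add_knLB_le p3 p1 hc ha fun h2 _ => ?_⟩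
  · have hm : 2 ≤ max x.1 (max x.2.1 x.2.2) := h2.trans (le_max_left _ _)
    have hle : x.1 * x.2.1 ≤ x.1 * x.2.1 * x.2.2 := Nat.le_mul_of_pos_right _ p3
    omega
  · have hm : 2 ≤ max x.1 (max x.2.1 x.2.2) := h2.trans ((le_max_left _ _).trans (le_max_right _ _))
    have hle : x.2.1 * x.2.2 ≤ x.1 * x.2.1 * x.2.2 := by
      rw [mul_assoc]; exact Nat.le_mul_of_pos_left _ p1
    omega
  · have hm : 2 ≤ max x.1 (max x.2.1 x.2.2) := h2.trans ((le_max_right _ _).trans (le_max_right _ _))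
    have hle : x.2.2 * x.1 ≤ x.1 * x.2.1 * x.2.2 := by
      rw [mul_comm x.2.2 x.1, mul_assoc, mul_comm x.2.1 x.2.2, ← mul_assoc]
      exact Nat.le_mul_of_pos_right _ p2
    omega

/-! ### The E3K condition on shape multisets -/

/-- **The E3K condition on a multiset of triples at order `M`** (multiset form of `STPPThreeRoomEnergy.E3kAdm`): every member `x`
with `2·vol x > M` satisfies `e3kLHS ≤ (vol x)²` for each of its three pair classes — letters `(x₁,x₂,x₃)` with the off-member sums
`(Σbc, Σca, Σab)` of the multiset (one copy of `x` removed), and the rotations `(x₂,x₃,x₁)` / `(x₃,x₁,x₂)` with the sums rotated alike.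
[original] -/
def AdmK (M : ℕ) (G : Multiset (ℕ × ℕ × ℕ)) : Prop :=
  ∀ x ∈ G, M < 2 * vol x →
    e3kLHS M x.1 x.2.1 x.2.2 ((G.erase x).map pbc).sum ((G.erase x).map pca).sum ((G.erase x).map pab).sum ≤ vol x ^ 2 ∧
    e3kLHS M x.2.1 x.2.2 x.1 ((G.erase x).map pca).sum ((G.erase x).map pab).sum ((G.erase x).map pbc).sum ≤ vol x ^ 2 ∧
    e3kLHS M x.2.2 x.1 x.2.1 ((G.erase x).map pab).sum ((G.erase x).map pbc).sum ((G.erase x).map pca).sum ≤ vol x ^ 2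

section admK
variable {M : ℕ}

/-- **Heredity of the E3K condition**: it passes to sub-multisets (of a family inside the universe of order `M`). [original] -/
theorem AdmK.mono {F G : Multiset (ℕ × ℕ × ℕ)} (h : AdmK M G) (hU : ∀ x ∈ G, InUniv M x) (hF : F ≤ G) : AdmK M F := by
  intro x hx h2
  have hxG : x ∈ G := Multiset.mem_of_le hF hx
  obtain ⟨p1, p2, p3, hV⟩ := InUniv.sides_vol (hU x hxG)
  obtain ⟨k1, k2, k3⟩ := (hU x hxG).knLB_pairs
  obtain ⟨g1, g2, g3⟩ := h x hxG h2
  have hV2 : x.2.1 * x.2.2 * x.1 ≤ M := by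
    calc x.2.1 * x.2.2 * x.1 = x.1 * x.2.1 * x.2.2 := by ring
      _ ≤ M := hV
  have hV3 : x.2.2 * x.1 * x.2.1 ≤ M := by
    calc x.2.2 * x.1 * x.2.1 = x.1 * x.2.1 * x.2.2 := by ring
      _ ≤ M := hV
  exact ⟨le_trans (e3kLHS_mono p1 p2 p3 hV k1 k2 k3 (erase_sum_le hF x pbc) (erase_sum_le hF x pca) (erase_sum_le hF x pab)) g1,
    le_trans (e3kLHS_mono p2 p3 p1 hV2 k2 k3 k1 (erase_sum_le hF x pca) (erase_sum_le hF x pab) (erase_sum_le hF x pbc)) g2,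
    le_trans (e3kLHS_mono p3 p1 p2 hV3 k3 k1 k2 (erase_sum_le hF x pab) (erase_sum_le hF x pbc) (erase_sum_le hF x pca)) g3⟩

variable {N : ℕ}

/-- **`E3kAdm` gives `AdmK` on the shape multiset** (the off-member sums of `GM a b c` at the shape of member `i` are the sums over
the indices `≠ i`, eng-2's `ShapeCert.erase_sum_GM`). [original] -/
theorem admK_GM (a b c : Fin N → ℕ) (hE : E3kAdm M a b c) : AdmK M (GM a b c) := by
  intro x hx h2
  obtain ⟨i, rfl⟩ := (mem_GM a b c).mp hx
  rw [erase_sum_GM, erase_sum_GM, erase_sum_GM]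
  obtain ⟨hAB, hBC, hCA⟩ := hE
  have h2' : M < 2 * (a i * b i * c i) := by simpa [shp, vol] using h2
  have eBC : b i * c i * a i = a i * b i * c i := by ring
  have eCA : c i * a i * b i = a i * b i * c i := by ring
  have g1 := hAB i h2'
  have g2 := hBC i (by rw [eBC]; exact h2')
  have g3 := hCA i (by rw [eCA]; exact h2')
  rw [eBC] at g2
  rw [eCA] at g3
  refine ⟨?_, ?_, ?_⟩
  · simpa [shp, vol, pab, pbc, pca] using g1
  · simpa [shp, vol, pab, pbc, pca] using g2
  · simpa [shp, vol, pab, pbc, pca] using g3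

end admK

section kill
/-! ### The E3K node kill is sound -/

variable {M : ℕ} {G : Multiset (ℕ × ℕ × ℕ)} {fam : List Sh}

/-- **the E3K kill of one member is sound**: a prefix member `t` killed with the prefix's off-member sums refutes `AdmK M G` for
every family `G` above the prefix (the sums only grow, `e3kLHS` is monotone in them — eng-2's `e3kLHS_mono`, whose side conditions
hold in the universe by `InUniv.knLB_pairs`). [original] -/
theorem AboveQ.false_of_e3kKillT (h : AboveQ M G fam) (hK : AdmK M G) {t : Sh} (ht : t ∈ fam)
    (hk : e3kKillT (divsQ M) M (aggOf M fam) t = true) : False := by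
  unfold e3kKillT at hk
  simp only [seqN_eq, Bool.and_eq_true, Bool.or_eq_true, decide_eq_true_eq, e3kLHSd_divsQ] at hk
  obtain ⟨h2, hlt⟩ := hk
  have wt := h.wf t ht
  have hxF : t.tr ∈ famT fam := tr_mem_famT ht
  have hxG : t.tr ∈ G := h.mem_G ht
  have hUx := h.univ _ hxG
  obtain ⟨p1, p2, p3, hV⟩ := InUniv.sides_vol hUx
  obtain ⟨k1, k2, k3⟩ := hUx.knLB_pairs
  have ea := congrArg Sh.a wt; have eb := congrArg Sh.b wt; have ec := congrArg Sh.c wt; have ev := congrArg Sh.V wt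
  have eab := congrArg Sh.ab wt; have ebc := congrArg Sh.bc wt; have eca := congrArg Sh.ca wt
  rw [shQ_a] at ea; rw [shQ_b] at eb; rw [shQ_c] at ec; rw [shQ_V] at ev
  rw [shQ_ab] at eab; rw [shQ_bc] at ebc; rw [shQ_ca] at eca
  have sA : (aggOf M fam).sbc - t.bc = (((famT fam).erase t.tr).map pbc).sum := by
    show sbc fam - t.bc = _; rw [sbc_eqQ h.wf, ebc]; exact erase_sum_eq hxF pbc
  have sB : (aggOf M fam).sca - t.ca = (((famT fam).erase t.tr).map pca).sum := by
    show sca fam - t.ca = _; rw [sca_eqQ h.wf, eca]; exact erase_sum_eq hxF pca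
  have sC : (aggOf M fam).sab - t.ab = (((famT fam).erase t.tr).map pab).sum := by
    show sab fam - t.ab = _; rw [sab_eqQ h.wf, eab]; exact erase_sum_eq hxF pab
  rw [sA, sB, sC, ea, eb, ec, ev] at hlt
  rw [ev] at h2
  have hV2 : t.tr.2.1 * t.tr.2.2 * t.tr.1 ≤ M := by
    calc t.tr.2.1 * t.tr.2.2 * t.tr.1 = t.tr.1 * t.tr.2.1 * t.tr.2.2 := by ring
      _ ≤ M := hV
  have hV3 : t.tr.2.2 * t.tr.1 * t.tr.2.1 ≤ M := by
    calc t.tr.2.2 * t.tr.1 * t.tr.2.1 = t.tr.1 * t.tr.2.1 * t.tr.2.2 := by ring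
      _ ≤ M := hV
  have hm1 := e3kLHS_mono (M := M) p1 p2 p3 hV k1 k2 k3 (erase_sum_le h.le t.tr pbc) (erase_sum_le h.le t.tr pca)
    (erase_sum_le h.le t.tr pab)
  have hm2 := e3kLHS_mono (M := M) p2 p3 p1 hV2 k2 k3 k1 (erase_sum_le h.le t.tr pca) (erase_sum_le h.le t.tr pab)
    (erase_sum_le h.le t.tr pbc)
  have hm3 := e3kLHS_mono (M := M) p3 p1 p2 hV3 k3 k1 k2 (erase_sum_le h.le t.tr pab) (erase_sum_le h.le t.tr pbc)
    (erase_sum_le h.le t.tr pca)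
  obtain ⟨g1, g2, g3⟩ := hK t.tr hxG h2
  rw [sq] at g1 g2 g3
  unfold vol at hlt g1 g2 g3
  rcases hlt with (l1 | l2) | l3
  · omega
  · omega
  · omega

/-- **the E3K node kill is sound**: a killed prefix has no E3K-admissible family above it [original] -/
theorem AboveQ.false_of_killK (h : AboveQ M G fam) (hK : AdmK M G) (hk : killK (divsQ M) M (aggOf M fam) fam = true) :
    False := by
  unfold killK at hk
  obtain ⟨t, ht, hkt⟩ := List.any_eq_true.mp hk
  exact h.false_of_e3kKillT hK ht hkt

/-- **the node kill of `checkQK` is sound** (E3⁺: g1's `AboveQ.false_of_killE`; E3K: `AboveQ.false_of_killK`) [original] -/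
theorem AboveQ.false_of_killEK (h : AboveQ M G fam) (hK : AdmK M G) (hk : killEK (divsQ M) M (aggOf M fam) fam = true) :
    False := by
  unfold killEK at hk
  rw [Bool.or_eq_true] at hk
  rcases hk with hk | hk
  · exact h.false_of_killE hk
  · exact h.false_of_killK hK hk

end kill

/-! ### The goal of the search induction -/

/-- What the search `dfsK` below the prefix `fam` with remaining candidate list `R` guarantees: no vQK-admissible family above the
prefix (vQ-admissible — `AboveQ` — and `AdmK`) beats, provided every tail member is listed in `R` or has ratio level `≤ loLev`.
[bookkeeping] -/
def GoalK (M : ℕ) (fam R : List Sh) : Prop :=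
  ∀ G : Multiset (ℕ × ℕ × ℕ), AboveQ M G fam → AdmK M G → M * D < gsumQ G →
    (∀ x ∈ G - famT fam, levTQ x ≤ loLev ∨ shQ M x ∈ R) → False

end Summit.MatrixMultiplication.MatrixMultiplication.Theorems.ShapeCertVQ
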